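import Summits.Ventures.WeilGRH.DualTrigKernelLatticeFastMoments
import Summits.Ventures.WeilGRH.DualTrigKernelLatticeFastRemainder
import Summits.Ventures.WeilGRH.DualTrigKernelLatticeWindowFamily
import HarnessLib

/-!
# Format D-K v3.2 (multi-lattice): soundness of the fast cell checker, part 2 — remainder, cells, rungs

Cell `rh-explicit`, WEIL TRACK — GRH ARM, route B (weil-grh-3).  Definitions: `DualTrigKernelLatticeFastDefs.lean`;
moments: `DualTrigKernelLatticeFastMoments.lean`; remainder: `DualTrigKernelLatticeFastRemainder.lean`.  Here: the cell theorems `cellLoP_sound` / `cellLoTP_sound` (= `cellLo3_sound` /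
`cellLoT3_sound` with the new sources), `latCellsOKP_sound`, `cellsOKP_sound`, `cellBounds_of_cellsOKP : CellBounds c`,
`cellBounds_of_partsP`, and the rungs `weilPositivityOnChar_family_of_checkP` (standard window `log(N+1)/2`) and
`weilPositivityOnChar_window_family_of_partsP` (window `tn/td`) = the `checkL` / `partsW` theorems of
`DualTrigKernelLattice.lean` / `DualTrigKernelLatticeWindowFamily.lean` with the cell bounds supplied by `cellsOKP`.
Everything here is PROVED; no named facts, no `sorry`, no kernel evaluation.
-/

noncomputable section

open Finset Real Complex

namespace Summit.Ventures.WeilGRH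

open Literature.Analysis.ValidatedNumerics.NumericsMP
open Literature.NumberTheory.LFunctions
open DualTrigTaylor DigammaVertical

namespace DKCert3

variable {c : DKCert3}

/-! ### The two cell bounds (fast) -/

/-- **The cell theorem (fast source).**  If `cellLoP b E j = some (lo, loT)` with `E` the product-form block
remainder of `terms3`, then on the cell `θ ∈ [2πj/Mc, 2π(j+1)/Mc]` the full function is `≥ lo/S` and the base
periodic part `≥ loT/S`.  The proof is `cellLo3_sound` with `momentsP_mem` and `remSum_le_remBlockP_hi`. [folklore] -/
theorem cellLoP_sound (hS : 0 < c.base.S) (hpi : MI.mem c.base.S Real.pi c.base.piI) {ρ : ℝ} (hρ : 0 < ρ)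
    (hrho : MI.mem c.base.S ρ c.base.rhoI) {Cr : ℝ} (hC : MI.mem c.base.S Cr c.base.constI) (hR : 1 ≤ c.base.R)
    {b : DKBlock} (hMc : 1 ≤ b.Mc) (hden : 1 ≤ b.etaDen) (hnin : 1 ≤ b.nin) (hnum : 1 ≤ b.etaNum)
    (heta : Real.pi / b.Mc ≤ (b.etaNum : ℝ) / b.etaDen) (htab : c.base.tabOK b = true)
    (hF : List.Forall₂ (DKCert.GRepr c.base.S c.base.R) c.terms3 c.terms3R)
    (hFb : List.Forall₂ (DKCert.GRepr c.base.S c.base.R) c.base.terms c.base.termsR)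
    (hr : ∀ l ∈ c.lats, MI.mem c.base.S (c.ratR l) l.rI) (j : ℤ)
    {lo loT : ℤ} (h : c.cellLoP b (c.remBlockP (c.etaI b) c.terms3) j = some (lo, loT))
    {θ : ℝ} (hθ1 : 2 * π * j / b.Mc ≤ θ) (hθ2 : θ ≤ 2 * π * (j + 1) / b.Mc) :
    ((lo : ℝ) / c.base.S ≤ (Complex.digamma ((c.base.sigR : ℂ) + (ρ * θ : ℝ) * I)).re + Cr + sumVal c.terms3R θ) ∧
      ((loT : ℝ) / c.base.S ≤ sumVal (DKCert.cList c.terms3 c.terms3R) θ) := by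
  have hSr : (0 : ℝ) < c.base.S := by exact_mod_cast hS
  have hMcr : (0 : ℝ) < b.Mc := by exact_mod_cast hMc
  set ts := c.terms3 with hts
  set rts := c.terms3R with hrts
  set θc : ℝ := (2 * j + 1) * π / b.Mc with hθc
  set ηr : ℝ := (b.etaNum : ℝ) / b.etaDen with hηr
  have hη0 : 0 ≤ ηr := by rw [hηr]; positivity
  set φ : ℝ := θ - θc with hφ
  have hθφ : θ = θc + φ := by rw [hφ]; ring
  have hφabs : |φ| ≤ ηr := by
    refine le_trans ?_ heta
    rw [abs_le]; constructor
    · rw [hφ, hθc]; have : 2 * π * j / b.Mc = (2 * j + 1) * π / b.Mc - π / b.Mc := by field_simp; ring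
      linarith
    · rw [hφ, hθc]; have : 2 * π * (j + 1) / b.Mc = (2 * j + 1) * π / b.Mc + π / b.Mc := by
        field_simp; ring
      linarith
  -- unpack cellLoP
  unfold cellLoP at h
  cases hmom : c.momentsP b j with
  | none => simp [hmom] at h
  | some acc =>
  cases hdig : c.base.digammaData b j with
  | none => simp [hmom, hdig] at h
  | some dd =>
  obtain ⟨BR, F0, F1, EF⟩ := dd
  simp only [hmom, hdig, Option.some.injEq, Prod.mk.injEq] at h
  obtain ⟨hlo, hloT⟩ := h
  -- the trig data
  obtain ⟨hmA, hmN⟩ := momentsP_mem hS hpi htab hMc hFb hr j hmom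
  have hmT := DKCert.periodicMom_mem hF hmA hmN
  have hrem := remSum_le_remBlockP_hi hS hη0 (c.mem_etaI b hden) hF
  have htrig := sum_sub_remSum_le_sumVal θc hφabs c.base.R rts
  have htrigT := sum_sub_remSum_le_sumVal θc hφabs c.base.R (DKCert.cList ts rts)
  have hremT := DKCert.remSum_cList_le hη0 c.base.R ts rts
  rw [← hθφ] at htrig htrigT
  -- the digamma data
  obtain ⟨F0r, F1r, hF0m, hF1m, hBRth, hD⟩ := DKCert.digammaData_sound hS hpi hρ hrho hMc hden j hdig
  have hBRm : MI.mem c.base.S ((BR.lo : ℝ) / c.base.S) BR := by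
    have := DKCert.mem_thin hS BR.lo
    have e : (⟨BR.lo, BR.lo⟩ : MI) = BR := by
      cases BR with | mk lo hi => simp only at hBRth; simp [hBRth]
    rw [e] at this; exact this
  have hDθ := hD θ hθ1 hθ2 hφabs
  -- coefficient lists
  set cs := c.base.coeffs acc.1 with hcs
  have hlen : cs.length = 2 * c.base.R := DKCert.coeffs_length _
  obtain ⟨c0, c1, rest, hsplit⟩ : ∃ c0 c1 rest, cs = c0 :: c1 :: rest := by
    match hh : cs, hlen with
    | [], hl => simp at hl; omega
    | [_], hl => simp at hl; omega
    | c0 :: c1 :: rest, _ => exact ⟨c0, c1, rest, rfl⟩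
  have hcm : DKCert.CoefMem c.base (fun m ↦ coefSum rts θc m) cs := by
    intro m hm; rw [hlen] at hm; exact DKCert.coeffs_mem hmA m hm
  set cr' : ℕ → ℝ := fun m ↦ coefSum rts θc m +
    (if m = 0 then (BR.lo : ℝ) / c.base.S + F0r + Cr else 0) + (if m = 1 then F1r else 0) with hcr'
  set cs' := (((c0.add BR).add F0).add c.base.constI) :: (c1.add F1) :: rest with hcs'
  have hcm' : DKCert.CoefMem c.base cr' cs' := by
    intro m hm
    have hm2 : m < cs.length := by rw [hsplit]; rw [hcs'] at hm; simpa using hm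
    have hbase := hcm m hm2
    rw [hsplit] at hbase
    rcases m with _ | _ | m
    · have e : cr' 0 = coefSum rts θc 0 + ((BR.lo : ℝ) / c.base.S + F0r + Cr) := by simp [hcr']
      rw [e, hcs']
      simp only [List.getD_cons_zero] at hbase ⊢
      have := MI.mem_add (MI.mem_add (MI.mem_add hbase hBRm) hF0m) hC
      have e2 : coefSum rts θc 0 + ((BR.lo : ℝ) / c.base.S + F0r + Cr) =
          coefSum rts θc 0 + (BR.lo : ℝ) / c.base.S + F0r + Cr := by ring
      rw [e2]; exact this
    · have e : cr' 1 = coefSum rts θc 1 + F1r := by simp [hcr']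
      rw [e, hcs']
      simp only [List.getD_cons_succ, List.getD_cons_zero] at hbase ⊢
      exact MI.mem_add hbase hF1m
    · have e : cr' (m + 2) = coefSum rts θc (m + 2) := by simp [hcr']
      rw [e, hcs']
      simp only [List.getD_cons_succ] at hbase ⊢
      exact hbase
  have hlen' : cs'.length = 2 * c.base.R := by
    rw [hcs']; rw [hsplit] at hlen; simpa using hlen
  have hpoly := DKCert.poly_ge_innerLo hS hden hnin hnum hcm' hφabs
  rw [hlen'] at hpoly
  -- the polynomial splits
  have hsplitpoly : DKCert.polyR cr' (2 * c.base.R) φ =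
      (∑ m ∈ range (2 * c.base.R), coefSum rts θc m * φ ^ m) + ((BR.lo : ℝ) / c.base.S + F0r + Cr) + F1r * φ := by
    simp only [DKCert.polyR, hcr', add_mul, Finset.sum_add_distrib, ite_mul, zero_mul]
    rw [Finset.sum_ite_eq' (range (2 * c.base.R)) 0, Finset.sum_ite_eq' (range (2 * c.base.R)) 1]
    simp only [Finset.mem_range, show 0 < 2 * c.base.R by omega, show 1 < 2 * c.base.R by omega, if_true,
      pow_zero, mul_one, pow_one]
  -- first conclusion
  have hE : remSum rts ηr c.base.R ≤ (((c.remBlockP (c.etaI b) ts).hi : ℤ) : ℝ) / c.base.S := hrem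
  refine ⟨?_, ?_⟩
  · rw [hsplit] at hlo
    dsimp only at hlo
    have : ((lo : ℤ) : ℝ) / c.base.S = ((c.base.innerLo b cs' : ℤ) : ℝ) / c.base.S -
        (((c.remBlockP (c.etaI b) ts).hi : ℤ) : ℝ) / c.base.S - ((EF.hi : ℤ) : ℝ) / c.base.S := by
      rw [← hlo, hcs']; push_cast; ring
    rw [this]
    linarith [hpoly, hsplitpoly, htrig, hDθ]
  · -- periodic part
    set csT := c.base.coeffs (c.base.periodicMom acc) with hcsT
    have hlenT : csT.length = 2 * c.base.R := DKCert.coeffs_length _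
    have hcmT : DKCert.CoefMem c.base (fun m ↦ coefSum (DKCert.cList ts rts) θc m) csT := by
      intro m hm; rw [hlenT] at hm; exact DKCert.coeffs_mem hmT m hm
    have hpolyT := DKCert.poly_ge_innerLo hS hden hnin hnum hcmT hφabs
    rw [hlenT] at hpolyT
    have : ((loT : ℤ) : ℝ) / c.base.S = ((c.base.innerLo b csT : ℤ) : ℝ) / c.base.S -
        (((c.remBlockP (c.etaI b) ts).hi : ℤ) : ℝ) / c.base.S := by
      rw [← hloT, hcsT]; push_cast; ring
    rw [this]
    have hpr : DKCert.polyR (fun m ↦ coefSum (DKCert.cList ts rts) θc m) (2 * c.base.R) φ =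
        ∑ m ∈ range (2 * c.base.R), coefSum (DKCert.cList ts rts) θc m * φ ^ m := rfl
    linarith [hpolyT, htrigT, hremT]

/-- **The cell bound without digamma, product remainder.**  If `cellLoT3 b ts E j = some lo` with `E` the
product-form block remainder of `ts`, then on the cell the sum of the real terms is `≥ lo/S`
(`cellLoT3_sound` with `remSum_le_remBlockP_hi`). [folklore] -/
theorem cellLoTP_sound (hS : 0 < c.base.S) (hpi : MI.mem c.base.S Real.pi c.base.piI)
    {b : DKBlock} (hMc : 1 ≤ b.Mc) (hden : 1 ≤ b.etaDen) (hnin : 1 ≤ b.nin) (hnum : 1 ≤ b.etaNum)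
    (heta : Real.pi / b.Mc ≤ (b.etaNum : ℝ) / b.etaDen) (htab : c.base.tabOK b = true)
    {ts : List DKCert.GTerm} {rts : List RTerm} (hF : List.Forall₂ (DKCert.GRepr c.base.S c.base.R) ts rts) (j : ℤ)
    {lo : ℤ} (h : c.cellLoT3 b ts (c.remBlockP (c.etaI b) ts) j = some lo)
    {θ : ℝ} (hθ1 : 2 * π * j / b.Mc ≤ θ) (hθ2 : θ ≤ 2 * π * (j + 1) / b.Mc) :
    (lo : ℝ) / c.base.S ≤ sumVal rts θ := by
  have hMcr : (0 : ℝ) < b.Mc := by exact_mod_cast hMc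
  set θc : ℝ := (2 * j + 1) * π / b.Mc with hθc
  set ηr : ℝ := (b.etaNum : ℝ) / b.etaDen with hηr
  have hη0 : 0 ≤ ηr := by rw [hηr]; positivity
  set φ : ℝ := θ - θc with hφ
  have hθφ : θ = θc + φ := by rw [hφ]; ring
  have hφabs : |φ| ≤ ηr := by
    refine le_trans ?_ heta
    rw [abs_le]; constructor
    · rw [hφ, hθc]; have : 2 * π * j / b.Mc = (2 * j + 1) * π / b.Mc - π / b.Mc := by field_simp; ring
      linarith
    · rw [hφ, hθc]; have : 2 * π * (j + 1) / b.Mc = (2 * j + 1) * π / b.Mc + π / b.Mc := by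
        field_simp; ring
      linarith
  unfold cellLoT3 at h
  cases hmom : c.moments3 b j ts with
  | none => simp [hmom] at h
  | some acc =>
  simp only [hmom, Option.some.injEq] at h
  obtain ⟨hmA, _⟩ := moments3_mem hS hpi htab hMc j hF hmom
  have hrem := remSum_le_remBlockP_hi hS hη0 (c.mem_etaI b hden) hF
  have htrig := sum_sub_remSum_le_sumVal θc hφabs c.base.R rts
  rw [← hθφ] at htrig
  set cs := c.base.coeffs acc.1 with hcs
  have hlen : cs.length = 2 * c.base.R := DKCert.coeffs_length _
  have hcm : DKCert.CoefMem c.base (fun m ↦ coefSum rts θc m) cs := by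
    intro m hm; rw [hlen] at hm; exact DKCert.coeffs_mem hmA m hm
  have hpoly := DKCert.poly_ge_innerLo hS hden hnin hnum hcm hφabs
  rw [hlen] at hpoly
  have : ((lo : ℤ) : ℝ) / c.base.S = ((c.base.innerLo b cs : ℤ) : ℝ) / c.base.S -
      (((c.remBlockP (c.etaI b) ts).hi : ℤ) : ℝ) / c.base.S := by
    rw [← h, hcs]; push_cast; ring
  rw [this]
  have hpr : DKCert.polyR (fun m ↦ coefSum rts θc m) (2 * c.base.R) φ =
      ∑ m ∈ range (2 * c.base.R), coefSum rts θc m * φ ^ m := rfl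
  linarith [hpoly, htrig, hrem]

/-! ### Unpacking `cellsOKP`; the cell bounds -/

/-- What `latCellsOKL` says on the product-remainder data: every lattice on duty has `mT_p ≤` the
trigonometric lower bound of its `T_p` on the cell. [folklore] -/
theorem latCellsOKP_sound {b : DKBlock} {j : ℤ} : ∀ (ls : List DKLat),
    c.latCellsOKL b ls (ls.map fun l ↦ (c.latTerms l, c.remBlockP (c.etaI b) (c.latTerms l))) j = true →
    ∀ l ∈ ls, c.latDuty l b j = true →
      ∃ lo, c.cellLoT3 b (c.latTerms l) (c.remBlockP (c.etaI b) (c.latTerms l)) j = some lo ∧ l.mT ≤ lo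
  | [], _ => by simp
  | l :: ls, h => by
      rw [List.map_cons] at h
      simp only [latCellsOKL, Bool.and_eq_true] at h
      obtain ⟨h1, h2⟩ := h
      intro l' hl' hduty
      rcases List.mem_cons.1 hl' with rfl | hl'
      · unfold latCellOKL at h1
        rw [hduty] at h1
        simp only [Bool.not_true, Bool.false_or] at h1
        split at h1
        · rename_i lov hlov
          exact ⟨lov, hlov, by simpa using h1⟩
        · simp at h1
      · exact latCellsOKP_sound ls h2 l' hl' hduty

/-- Unpacking `cellsOKP` on one cell. [folklore] -/
theorem cellsOKP_sound (h : c.cellsOKP = true) {b : DKBlock} (hb : b ∈ c.base.blocks) {i : ℕ} (hi : i < b.n) :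
    (∃ lo loT : ℤ, c.cellLoP b (c.remBlockP (c.etaI b) c.terms3) (b.j0 + i) = some (lo, loT) ∧
      0 ≤ lo ∧ (DKCert.periodDuty b (b.j0 + i) = true → c.base.mT ≤ loT)) ∧
    ∀ l ∈ c.lats, c.latDuty l b (b.j0 + i) = true →
      ∃ lo, c.cellLoT3 b (c.latTerms l) (c.remBlockP (c.etaI b) (c.latTerms l)) (b.j0 + i) = some lo ∧
        l.mT ≤ lo := by
  unfold cellsOKP at h
  rw [List.all_eq_true] at h
  have hb' := h b hb
  unfold blockRangeOKP at hb'
  simp only [List.all_eq_true, List.mem_range, Bool.and_eq_true] at hb'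
  obtain ⟨hc, hl⟩ := hb' i hi
  simp only [zero_add] at hc hl
  refine ⟨?_, latCellsOKP_sound c.lats hl⟩
  unfold cellOKP at hc
  cases hcl : c.cellLoP b (c.remBlockP (c.etaI b) c.terms3) (b.j0 + i) with
  | none => simp [hcl] at hc
  | some p =>
    obtain ⟨lo, loT⟩ := p
    simp only [hcl, Bool.and_eq_true, decide_eq_true_eq, Bool.or_eq_true, Bool.not_eq_true'] at hc
    refine ⟨lo, loT, rfl, hc.1, fun hd ↦ ?_⟩
    rcases hc.2 with h' | h'
    · rw [hd] at h'; exact absurd h' (by decide)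
    · exact h'

/-- **`cellsOKP` gives the cell bounds.** [folklore] -/
theorem cellBounds_of_cellsOKP (hS : 0 < c.base.S) (hpi : MI.mem c.base.S Real.pi c.base.piI)
    (hrho : MI.mem c.base.S c.base.rhoR c.base.rhoI) (hρ : 0 < c.base.rhoR)
    (hC : MI.mem c.base.S c.base.constR c.base.constI) (hR : 1 ≤ c.base.R)
    (hF : List.Forall₂ (DKCert.GRepr c.base.S c.base.R) c.terms3 c.terms3R)
    (hFb : List.Forall₂ (DKCert.GRepr c.base.S c.base.R) c.base.terms c.base.termsR)
    (hr : ∀ l ∈ c.lats, MI.mem c.base.S (c.ratR l) l.rI)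
    (hFl : ∀ l ∈ c.lats, List.Forall₂ (DKCert.GRepr c.base.S c.base.R) (c.latTerms l) (c.latTermsR l))
    (hblocks : c.base.blocksOK = true) (hcells : c.cellsOKP = true) : CellBounds c := by
  intro b hb i hi θ h1 h2
  obtain ⟨hbs, _, _⟩ := DKCert.blocksOK_sound hblocks
  obtain ⟨hMc, hn, hnin, hden, heta, htab⟩ := hbs b hb
  obtain ⟨heta', hnum⟩ := DKCert.eta_ge hS hpi hMc hden heta
  obtain ⟨⟨lo, loT, hcl, hlo, hduty⟩, hlat⟩ := cellsOKP_sound hcells hb hi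
  have hSr : (0 : ℝ) < c.base.S := by exact_mod_cast hS
  obtain ⟨hP, hT⟩ := cellLoP_sound hS hpi hρ hrho hC hR hMc hden hnin hnum heta' htab hF hFb hr (b.j0 + i) hcl
    (θ := θ) (by push_cast at h1 ⊢; linarith) (by push_cast at h2 ⊢; linarith)
  refine ⟨?_, fun hd ↦ ?_, fun l hl hd ↦ ?_⟩
  · have hlo0 : (0 : ℝ) ≤ lo := by exact_mod_cast hlo
    have : (0 : ℝ) ≤ (lo : ℝ) / c.base.S := div_nonneg hlo0 hSr.le
    unfold P3; linarith
  · have : ((c.base.mT : ℤ) : ℝ) / c.base.S ≤ (loT : ℝ) / c.base.S := by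
      gcongr; exact_mod_cast hduty hd
    exact this.trans hT
  · obtain ⟨lol, hlol, hle⟩ := hlat l hl hd
    have hTl := cellLoTP_sound hS hpi hMc hden hnin hnum heta' htab (hFl l hl) (b.j0 + i) hlol
      (θ := θ) (by push_cast at h1 ⊢; linarith) (by push_cast at h2 ⊢; linarith)
    have : ((l.mT : ℤ) : ℝ) / c.base.S ≤ (lol : ℝ) / c.base.S := by gcongr
    exact this.trans hTl

/-- The cell bounds from the frame flags, the lattice facts and `cellsOKP`. [folklore] -/
theorem cellBounds_of_partsP (hconsts : c.base.constsOK = true) (hvals : c.base.valsOK = true)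
    (hblocks : c.base.blocksOK = true) (hratm : ∀ l ∈ c.lats, MI.mem c.base.S (c.ratR l) l.rI)
    (hwin : ∀ l ∈ c.lats, (c.latWinTerms l).isSome = true) (hcells : c.cellsOKP = true) : CellBounds c := by
  obtain ⟨hS, hp0, hD, _, hR, _, hpi, hlog, hrho, hC⟩ := DKCert.constsOK_sound hconsts
  obtain ⟨hρ, _⟩ := DKCert.rhoR_pos_and_mul hp0 hD
  have hFb := DKCert.terms_repr hS hpi hlog hp0 hvals
  have hF := terms3_repr hS hpi hlog hp0 hvals hratm
  have hFl : ∀ l ∈ c.lats, List.Forall₂ (DKCert.GRepr c.base.S c.base.R) (c.latTerms l) (c.latTermsR l) := by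
    intro l hl
    obtain ⟨ws, hws⟩ := Option.isSome_iff_exists.1 (hwin l hl)
    exact latTerms_repr hS hpi hlog hp0 hvals (hratm l hl) hws
  exact cellBounds_of_cellsOKP hS hpi hrho hρ hC hR hF hFb hratm hFl hblocks hcells

/-! ### The rungs from `checkP` / the fast window parts -/

/-- **The rung for the whole key group, every modulus `q ≥ c.base.q`, from `checkP`** (standard window
`log(N+1)/2`; `weilPositivityOnChar_family_of_checkL` with the cells through `cellsOKP`). [folklore] -/
theorem weilPositivityOnChar_family_of_checkP (hc : c.checkP = true) {q : ℕ} (hq : c.base.q ≤ q) (hq1 : q ≠ 1)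
    (χ : DirichletCharacter ℂ q) (hpar : charParity χ = c.base.par)
    (hχ : ∀ val ∈ c.base.vals, χ (val.n : ZMod q) = DKCert.valZ val)
    (hχ0 : ∀ n : ℕ, n ≤ c.base.N → IsPrimePow n → ¬ Nat.Coprime n c.base.q → χ (n : ZMod q) = 0) :
    WeilPositivityOnChar χ (Real.log ((c.base.N : ℝ) + 1) / 2) := by
  unfold checkP at hc
  simp only [Bool.and_eq_true] at hc
  obtain ⟨hf, hcells⟩ := hc
  have hf' := hf
  unfold frame3OK baseFrameOK at hf'
  simp only [Bool.and_eq_true] at hf'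
  obtain ⟨⟨⟨⟨⟨⟨⟨hconsts, hvals⟩, hnodup⟩, hblocks⟩, _⟩, hlats⟩, hcover⟩, htail⟩ := hf'
  obtain ⟨hS, _, _, _, _, _, _, hlog, _, _⟩ := DKCert.constsOK_sound hconsts
  obtain ⟨_, _, hlat⟩ := latsOK_sound hlats hS hlog
  exact weilPositivityOnChar_of_trigDual hq1 χ c.base.N c.allAtomsT (allAtomsT_admissible_of_frame hf)
    (sound_familyL_of_partsCB hconsts hvals hnodup hblocks hlats hcover htail
      (cellBounds_of_partsP hconsts hvals hblocks (fun l hl ↦ (hlat l hl).2.2.2.2.1)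
        (fun l hl ↦ (hlat l hl).2.2.2.2.2.2.2) hcells) hq χ hpar hχ hχ0)

/-- **The rung on a general window `[−tn/td, tn/td]` for the whole key group, every modulus `q ≥ c.base.q`,
from the fast window parts** (`weilPositivityOnChar_window_family_of_partsW` with the cells through `cellsOKP`).
[folklore] -/
theorem weilPositivityOnChar_window_family_of_partsP (hconsts : c.base.constsOK = true)
    (hvals : c.base.valsOK = true) (hnodup : c.base.valsNodup = true) (hblocks : c.base.blocksOK = true)
    {tn td : ℕ} (htd : 0 < td) (hlats : c.latsOKw tn td = true) (hcover : c.latCoverOK = true)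
    (htail : c.tailOK3 = true) (hcells : c.cellsOKP = true)
    (hwin : (c.base.atoms.all fun atm =>
      decide ((2 * tn * c.base.D * c.base.S : ℤ) ≤ (atm.k : ℤ) * c.base.logp0C.1 * td)) = true)
    (hN : Real.exp (2 * ((tn : ℝ) / td)) ≤ (c.base.N : ℝ) + 1)
    {q : ℕ} (hq : c.base.q ≤ q) (hq1 : q ≠ 1) (χ : DirichletCharacter ℂ q) (hpar : charParity χ = c.base.par)
    (hχ : ∀ val ∈ c.base.vals, χ (val.n : ZMod q) = DKCert.valZ val)
    (hχ0 : ∀ n : ℕ, n ≤ c.base.N → IsPrimePow n → ¬ Nat.Coprime n c.base.q → χ (n : ZMod q) = 0) :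
    WeilPositivityOnChar χ ((tn : ℝ) / td) := by
  obtain ⟨hS, _, _, _, _, _, _, hlog, _, _⟩ := DKCert.constsOK_sound hconsts
  obtain ⟨_, _, hlat⟩ := latsOKw_sound hlats hS hlog
  exact weilPositivityOnChar_of_trigDual_window hq1 χ c.base.N hN c.allAtomsT
    (allAtomsT_window hconsts htd hwin hlats)
    (sound_familyL_of_partsWCB hconsts hvals hnodup hblocks hlats hcover htail
      (cellBounds_of_partsP hconsts hvals hblocks (fun l hl ↦ (hlat l hl).2.2.2.2.1)
        (fun l hl ↦ (hlat l hl).2.2.2.2.2.2.2) hcells) hq χ hpar hχ hχ0)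

end DKCert3

end Summit.Ventures.WeilGRH

end
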